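import Mathlib
import Summits.AtomisticToContinuum.FouriersLaw.Theses.EmbeddedDrudeMourre
import Summits.AtomisticToContinuum.FouriersLaw.Theorems.EmbeddedDrudeMourreDrudeDissolutionStubExcursionSecondDifferenceGradientDecomposition
import Summits.AtomisticToContinuum.FouriersLaw.Theorems.EmbeddedDrudeMourreDrudeDissolutionStubExcursionSecondDifferenceDetFloorAlgebra
import Summits.AtomisticToContinuum.FouriersLaw.Theorems.EmbeddedDrudeMourreDrudeDissolutionStubExcursionSecondDifferenceFloorLocalComoving
import HarnessLib

/-!
# The local gradient floor where the three gradients `∇S₁, ∇S₂, ∇A` are independent (triple points)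
# (stub B1b″ of line `kinetic-polymer-gas-on-the-time-axis`, step L4 of the gradient floor (C4))
(crux `EmbeddedDrudeMourre.DrudeDissolution`, item stmt-AtomisticToContinuum-12593; `--supports` file, closes
nothing; lead c13)

WHAT. `gradient_floor_local_det`: let `Ω = σ·A·S₁·S₂` (`σ = ±1`, `A ∈ C¹`, cell order, `S₁ p = sin((p.2.1−p.1)/2)`,
`S₂ p = sin((p.2.1−p.2.2)/2)`). At a point `p₀` where the two half-angle cosines do not vanish and `A` is
non-degenerate along the diagonal, `fderiv A p₀ (1,1,1) ≠ 0` — e.g. at the triple points `(±κ*,±κ*,±κ*)`, where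
all of `S₁, S₂, A` vanish and `sheetFn_diag_deriv_ne_zero` gives the hypothesis — there are `r, c > 0` with
`c·(A²S₁² + A²S₂² + S₁²S₂²) ≤ (∂₁Ω)² + (∂₂Ω)² + (∂₃Ω)²` on `dist p p₀ < r`: the full transversal coordinate `m²` of the
floor is controlled near the triple points.

HOW. `∇Ω = σ(AS₂·∇S₁ + AS₁·∇S₂ + S₁S₂·∇A)` (`fderiv_factorised_apply`); the determinant of
`(∇S₁, ∇S₂, ∇A) = ((−c₁/2, c₁/2, 0), (0, c₂/2, −c₂/2), (a₁,a₂,a₃))` is `−(c₁c₂/4)(a₁+a₂+a₃)`, non-zero at `p₀` and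
hence floored nearby, the entries are bounded nearby, and `sumSq_lincomb3_ge_of_det` converts this into the floor.
-/

noncomputable section

open Set Real Topology Metric
open Literature.MathematicalPhysics.KineticTheory
open Literature.MathematicalPhysics.KineticTheory.PhononBoltzmann

namespace Summit.AtomisticToContinuum.FouriersLaw.Theorems.DrudeDissolution.KineticPolymerGasOnTheTimeAxis

/-- **Registered sub-goal `gradient_floor_local_det` (L4 of the gradient floor): the local floor at a point where
`∇S₁, ∇S₂, ∇A` are linearly independent.** Let `Ω q = σ·A q·sin((q.2.1−q.1)/2)·sin((q.2.1−q.2.2)/2)` with `σ = ±1`,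
`A ∈ C¹`. If `cos((p₀.2.1−p₀.1)/2) ≠ 0`, `cos((p₀.2.1−p₀.2.2)/2) ≠ 0` and `fderiv A p₀ (1,1,1) ≠ 0`, then there are
`r, c > 0` such that for `dist p p₀ < r`, with `S₁ = sin((p.2.1−p.1)/2)`, `S₂ = sin((p.2.1−p.2.2)/2)`:
`c·((A p)²S₁² + (A p)²S₂² + S₁²S₂²) ≤ (fderiv Ω p (1,0,0))² + (fderiv Ω p (0,1,0))² + (fderiv Ω p (0,0,1))²`.
[folklore] -/
theorem gradient_floor_local_det :
    ∀ (Ω A : ℝ × ℝ × ℝ → ℝ) (σ : ℝ) (p₀ : ℝ × ℝ × ℝ), (σ = 1 ∨ σ = -1) → ContDiff ℝ 1 A →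
      (∀ q, Ω q = σ * A q * Real.sin ((q.2.1 - q.1) / 2) * Real.sin ((q.2.1 - q.2.2) / 2)) →
      Real.cos ((p₀.2.1 - p₀.1) / 2) ≠ 0 → Real.cos ((p₀.2.1 - p₀.2.2) / 2) ≠ 0 →
      fderiv ℝ A p₀ (1, 1, 1) ≠ 0 →
      ∃ r c : ℝ, 0 < r ∧ 0 < c ∧ ∀ p : ℝ × ℝ × ℝ, dist p p₀ < r →
        c * ((A p) ^ 2 * Real.sin ((p.2.1 - p.1) / 2) ^ 2 + (A p) ^ 2 * Real.sin ((p.2.1 - p.2.2) / 2) ^ 2 +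
            Real.sin ((p.2.1 - p.1) / 2) ^ 2 * Real.sin ((p.2.1 - p.2.2) / 2) ^ 2) ≤
          (fderiv ℝ Ω p (1, 0, 0)) ^ 2 + (fderiv ℝ Ω p (0, 1, 0)) ^ 2 + (fderiv ℝ Ω p (0, 0, 1)) ^ 2 := by
  intro Ω A σ p₀ hσ hA hΩ hc₁ hc₂ hdiag
  have hσ2 : σ ^ 2 = 1 := by rcases hσ with h | h <;> rw [h] <;> norm_num
  have hAd : ∀ p, DifferentiableAt ℝ A p := fun p => (hA.differentiable one_ne_zero) p
  have hfd : Continuous fun p => fderiv ℝ A p := hA.continuous_fderiv one_ne_zero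
  have ha : ∀ e : ℝ × ℝ × ℝ, Continuous fun p => fderiv ℝ A p e := fun e =>
    (ContinuousLinearMap.apply ℝ ℝ e).continuous.comp hfd
  have cc₁ : Continuous fun p : ℝ × ℝ × ℝ => Real.cos ((p.2.1 - p.1) / 2) := by fun_prop
  have cc₂ : Continuous fun p : ℝ × ℝ × ℝ => Real.cos ((p.2.1 - p.2.2) / 2) := by fun_prop
  -- the squared determinant as a continuous function
  set F : ℝ × ℝ × ℝ → ℝ := fun p => (Real.cos ((p.2.1 - p.1) / 2) * Real.cos ((p.2.1 - p.2.2) / 2) / 4 *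
      (fderiv ℝ A p (1, 0, 0) + fderiv ℝ A p (0, 1, 0) + fderiv ℝ A p (0, 0, 1))) ^ 2 with hF
  have cF : Continuous F := by
    rw [hF]; exact (((cc₁.mul cc₂).div_const 4).mul (((ha _).add (ha _)).add (ha _))).pow 2
  have hsum : fderiv ℝ A p₀ (1, 0, 0) + fderiv ℝ A p₀ (0, 1, 0) + fderiv ℝ A p₀ (0, 0, 1) = fderiv ℝ A p₀ (1, 1, 1) := by
    rw [← map_add, ← map_add]; norm_num
  have hF0 : 0 < F p₀ := by
    have e : F p₀ = (Real.cos ((p₀.2.1 - p₀.1) / 2) * Real.cos ((p₀.2.1 - p₀.2.2) / 2) / 4 *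
        fderiv ℝ A p₀ (1, 1, 1)) ^ 2 := by simp only [hF, hsum]
    rw [e]
    have : Real.cos ((p₀.2.1 - p₀.1) / 2) * Real.cos ((p₀.2.1 - p₀.2.2) / 2) / 4 * fderiv ℝ A p₀ (1, 1, 1) ≠ 0 := by
      refine mul_ne_zero (div_ne_zero (mul_ne_zero hc₁ hc₂) four_ne_zero) hdiag
    positivity
  -- the entry bound
  set G : ℝ × ℝ × ℝ → ℝ := fun p => |fderiv ℝ A p (1, 0, 0)| + |fderiv ℝ A p (0, 1, 0)| + |fderiv ℝ A p (0, 0, 1)|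
    with hG
  have cG : Continuous G := by rw [hG]; exact (((ha _).abs).add ((ha _).abs)).add ((ha _).abs)
  obtain ⟨r₁, hr₁, hb₁⟩ := exists_ball_gt_of_continuousAt cF.continuousAt (half_lt_self hF0)
  obtain ⟨r₂, hr₂, hb₂⟩ := exists_ball_lt_of_continuousAt cG.continuousAt (lt_add_one (G p₀))
  set B : ℝ := G p₀ + 1 with hB
  have hB1 : 1 ≤ B := by
    have h0 : 0 ≤ G p₀ := by rw [hG]; positivity
    rw [hB]; linarith
  have hBpos : 0 < B := lt_of_lt_of_le one_pos hB1
  refine ⟨min r₁ r₂, F p₀ / 2 / (36 * B ^ 4), lt_min hr₁ hr₂, by positivity, fun p hp => ?_⟩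
  have hp₁ : dist p p₀ < r₁ := lt_of_lt_of_le hp (min_le_left _ _)
  have hp₂ : dist p p₀ < r₂ := lt_of_lt_of_le hp (min_le_right _ _)
  -- entries at `p`
  have hGp := hb₂ p hp₂
  have ha1 : |fderiv ℝ A p (1, 0, 0)| ≤ B := by
    rw [hB]; have := abs_nonneg (fderiv ℝ A p (0, 1, 0)); have := abs_nonneg (fderiv ℝ A p (0, 0, 1))
    simp only [hG] at hGp ⊢; linarith
  have ha2 : |fderiv ℝ A p (0, 1, 0)| ≤ B := by
    rw [hB]; have := abs_nonneg (fderiv ℝ A p (1, 0, 0)); have := abs_nonneg (fderiv ℝ A p (0, 0, 1))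
    simp only [hG] at hGp ⊢; linarith
  have ha3 : |fderiv ℝ A p (0, 0, 1)| ≤ B := by
    rw [hB]; have := abs_nonneg (fderiv ℝ A p (1, 0, 0)); have := abs_nonneg (fderiv ℝ A p (0, 1, 0))
    simp only [hG] at hGp ⊢; linarith
  have hcos1 : |-(Real.cos ((p.2.1 - p.1) / 2) / 2)| ≤ B := by
    rw [abs_neg, abs_div, abs_two]
    exact ((div_le_one two_pos).2 ((Real.abs_cos_le_one _).trans one_le_two)).trans hB1
  have hcos1' : |Real.cos ((p.2.1 - p.1) / 2) / 2| ≤ B := by rwa [abs_neg] at hcos1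
  have hcos2 : |Real.cos ((p.2.1 - p.2.2) / 2) / 2| ≤ B := by
    rw [abs_div, abs_two]
    exact ((div_le_one two_pos).2 ((Real.abs_cos_le_one _).trans one_le_two)).trans hB1
  have hcos2' : |-(Real.cos ((p.2.1 - p.2.2) / 2) / 2)| ≤ B := by rwa [abs_neg]
  have hzero : |(0 : ℝ)| ≤ B := by rw [abs_zero]; exact hBpos.le
  -- the determinant floor at `p`
  have halg := sumSq_lincomb3_ge_of_det
    (-(Real.cos ((p.2.1 - p.1) / 2) / 2)) (Real.cos ((p.2.1 - p.1) / 2) / 2) 0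
    0 (Real.cos ((p.2.1 - p.2.2) / 2) / 2) (-(Real.cos ((p.2.1 - p.2.2) / 2) / 2))
    (fderiv ℝ A p (1, 0, 0)) (fderiv ℝ A p (0, 1, 0)) (fderiv ℝ A p (0, 0, 1)) B
    hcos1 hcos1' hzero hzero hcos2 hcos2' ha1 ha2 ha3
    (σ * (A p * Real.sin ((p.2.1 - p.2.2) / 2))) (σ * (A p * Real.sin ((p.2.1 - p.1) / 2)))
    (σ * (Real.sin ((p.2.1 - p.1) / 2) * Real.sin ((p.2.1 - p.2.2) / 2)))
  -- identify the determinant with `F p` and the combination with `∇Ω`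
  have hdet : (-(Real.cos ((p.2.1 - p.1) / 2) / 2) *
        (Real.cos ((p.2.1 - p.2.2) / 2) / 2 * fderiv ℝ A p (0, 0, 1) -
          -(Real.cos ((p.2.1 - p.2.2) / 2) / 2) * fderiv ℝ A p (0, 1, 0)) +
      Real.cos ((p.2.1 - p.1) / 2) / 2 *
        (-(Real.cos ((p.2.1 - p.2.2) / 2) / 2) * fderiv ℝ A p (1, 0, 0) - 0 * fderiv ℝ A p (0, 0, 1)) +
      0 * (0 * fderiv ℝ A p (0, 1, 0) - Real.cos ((p.2.1 - p.2.2) / 2) / 2 * fderiv ℝ A p (1, 0, 0))) ^ 2 = F p := by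
    simp only [hF]; ring
  have hm : (σ * (A p * Real.sin ((p.2.1 - p.2.2) / 2))) ^ 2 + (σ * (A p * Real.sin ((p.2.1 - p.1) / 2))) ^ 2 +
      (σ * (Real.sin ((p.2.1 - p.1) / 2) * Real.sin ((p.2.1 - p.2.2) / 2))) ^ 2 =
      (A p) ^ 2 * Real.sin ((p.2.1 - p.1) / 2) ^ 2 + (A p) ^ 2 * Real.sin ((p.2.1 - p.2.2) / 2) ^ 2 +
        Real.sin ((p.2.1 - p.1) / 2) ^ 2 * Real.sin ((p.2.1 - p.2.2) / 2) ^ 2 := by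
    have : (σ * (A p * Real.sin ((p.2.1 - p.2.2) / 2))) ^ 2 + (σ * (A p * Real.sin ((p.2.1 - p.1) / 2))) ^ 2 +
      (σ * (Real.sin ((p.2.1 - p.1) / 2) * Real.sin ((p.2.1 - p.2.2) / 2))) ^ 2 =
      σ ^ 2 * ((A p) ^ 2 * Real.sin ((p.2.1 - p.1) / 2) ^ 2 + (A p) ^ 2 * Real.sin ((p.2.1 - p.2.2) / 2) ^ 2 +
        Real.sin ((p.2.1 - p.1) / 2) ^ 2 * Real.sin ((p.2.1 - p.2.2) / 2) ^ 2) := by ring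
    rw [this, hσ2, one_mul]
  obtain ⟨e11, e12, e13⟩ := fderiv_S1_apply p
  obtain ⟨e21, e22, e23⟩ := fderiv_S2_apply p
  have d1 := fderiv_factorised_apply Ω A σ p (1, 0, 0) (hAd p) hΩ
  have d2 := fderiv_factorised_apply Ω A σ p (0, 1, 0) (hAd p) hΩ
  have d3 := fderiv_factorised_apply Ω A σ p (0, 0, 1) (hAd p) hΩ
  rw [e11, e21] at d1
  rw [e12, e22] at d2
  rw [e13, e23] at d3
  have hD : (σ * (A p * Real.sin ((p.2.1 - p.2.2) / 2)) * -(Real.cos ((p.2.1 - p.1) / 2) / 2) +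
        σ * (A p * Real.sin ((p.2.1 - p.1) / 2)) * 0 +
        σ * (Real.sin ((p.2.1 - p.1) / 2) * Real.sin ((p.2.1 - p.2.2) / 2)) * fderiv ℝ A p (1, 0, 0)) ^ 2 +
      (σ * (A p * Real.sin ((p.2.1 - p.2.2) / 2)) * (Real.cos ((p.2.1 - p.1) / 2) / 2) +
        σ * (A p * Real.sin ((p.2.1 - p.1) / 2)) * (Real.cos ((p.2.1 - p.2.2) / 2) / 2) +
        σ * (Real.sin ((p.2.1 - p.1) / 2) * Real.sin ((p.2.1 - p.2.2) / 2)) * fderiv ℝ A p (0, 1, 0)) ^ 2 +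
      (σ * (A p * Real.sin ((p.2.1 - p.2.2) / 2)) * 0 +
        σ * (A p * Real.sin ((p.2.1 - p.1) / 2)) * -(Real.cos ((p.2.1 - p.2.2) / 2) / 2) +
        σ * (Real.sin ((p.2.1 - p.1) / 2) * Real.sin ((p.2.1 - p.2.2) / 2)) * fderiv ℝ A p (0, 0, 1)) ^ 2 =
      (fderiv ℝ Ω p (1, 0, 0)) ^ 2 + (fderiv ℝ Ω p (0, 1, 0)) ^ 2 + (fderiv ℝ Ω p (0, 0, 1)) ^ 2 := by
    rw [d1, d2, d3]; ring
  rw [hdet, hm, hD] at halg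
  -- `F p ≥ F p₀ / 2`
  have hFp : F p₀ / 2 ≤ F p := le_of_lt (hb₁ p hp₁)
  have hm0 : 0 ≤ (A p) ^ 2 * Real.sin ((p.2.1 - p.1) / 2) ^ 2 + (A p) ^ 2 * Real.sin ((p.2.1 - p.2.2) / 2) ^ 2 +
      Real.sin ((p.2.1 - p.1) / 2) ^ 2 * Real.sin ((p.2.1 - p.2.2) / 2) ^ 2 := by positivity
  have h36 : 0 < 36 * B ^ 4 := by positivity
  rw [div_mul_eq_mul_div, div_le_iff₀ h36]
  calc F p₀ / 2 * ((A p) ^ 2 * Real.sin ((p.2.1 - p.1) / 2) ^ 2 + (A p) ^ 2 * Real.sin ((p.2.1 - p.2.2) / 2) ^ 2 +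
        Real.sin ((p.2.1 - p.1) / 2) ^ 2 * Real.sin ((p.2.1 - p.2.2) / 2) ^ 2)
      ≤ F p * ((A p) ^ 2 * Real.sin ((p.2.1 - p.1) / 2) ^ 2 + (A p) ^ 2 * Real.sin ((p.2.1 - p.2.2) / 2) ^ 2 +
        Real.sin ((p.2.1 - p.1) / 2) ^ 2 * Real.sin ((p.2.1 - p.2.2) / 2) ^ 2) := mul_le_mul_of_nonneg_right hFp hm0
    _ ≤ 36 * B ^ 4 * ((fderiv ℝ Ω p (1, 0, 0)) ^ 2 + (fderiv ℝ Ω p (0, 1, 0)) ^ 2 + (fderiv ℝ Ω p (0, 0, 1)) ^ 2) := halg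
    _ = ((fderiv ℝ Ω p (1, 0, 0)) ^ 2 + (fderiv ℝ Ω p (0, 1, 0)) ^ 2 + (fderiv ℝ Ω p (0, 0, 1)) ^ 2) * (36 * B ^ 4) := by
        ring

end Summit.AtomisticToContinuum.FouriersLaw.Theorems.DrudeDissolution.KineticPolymerGasOnTheTimeAxis

end
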